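import Summits.HodgeConjecture.CorCM.GaloisTwoPowerOrderFourReduction
import Summits.HodgeConjecture.CorCM.GaloisIndexTwoTwoCyclic
import Summits.HodgeConjecture.CorCM.GaloisDicyclicNondegenerate
import Summits.HodgeConjecture.CorCM.AbelianTwoPowerClassification
import Summits.HodgeConjecture.CorCM.AbelianCMFieldsAllTypesNondegenerate
import Mathlib.GroupTheory.GroupAction.ConjAct
import HarnessLib

/-!
# GOOD Galois CM fields of `2`-power degree whose order-`4` automorphisms square to complex conjugation:
# `Gal(K/ℚ) = H × E` with `|E| ≤ 2` — i.e. `Gal(K/ℚ)` is `C`, `Q`, `C × C₂` or `Q × C₂`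

COR-CM (cell `pub-hodgecm2`), binder seat b04 (gen 34), count-neutral own lane «Galois-CM-type classification».  KERNEL ONLY:
theorems; no definition, no named fact, no `sorry`.  `HC_CM` is neither used nor claimed.  Task (R1) of
`CorCM/GaloisTwoPowerOrderFourReduction` (gen 34): there, GOOD + `[K:ℚ] = 2^n ≥ 64` + (H2) «`σ⁴ = 1 ⟹ σ² ∈ {1, c}`» gave
`Gal(K/ℚ) = H × E` (`H.IsComplement' E`, `E` central elementary abelian, `c ∉ E`, `H ∋ c` cyclic or generalised quaternion).  HERE:
**`|E| ≤ 2`** — if `|E| ≥ 4` take `t₁ ≠ t₂` in `E ∖ 1`; `H` cyclic ⟹ `Gal(K/ℚ)` ABELIAN of exponent `|H| ≤ [K:ℚ]/4`, so `c` lies in no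
cyclic subgroup of index `≤ 2` and the abelian classification (gens 15–16) makes `K` BAD; `H ≅ Q_{2^k}` with cyclic part `⟨a⟩ ∋ c` and
`x ∈ H ∖ ⟨a⟩` ⟹ `A = ⟨a⟩·E` is abelian of index two containing `c` and the independent `c`-avoiding central involutions `t₁, t₂`,
and gen 30's `SplitInvolution.exists_simple_degenerate_of_two_cyclic` makes `K` BAD.  So **GOOD + (H2) ⟹ `Gal(K/ℚ)` is `C_{2^n}`,
`Q_{2^n}`, `C_{2^(n-1)} × C₂` (`c ∈ C`) or `Q_{2^(n-1)} × C₂` (`c ∈ Q`)** (all GOOD by gens 11/15/20/30): the `2`-power classification is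
reduced to the single statement «GOOD ⟹ (H2)».

* `exists_index_two_data_of_mulEquiv_quaternionGroup` — from `f : H ≃* QuaternionGroup m`: elements `a, x ∈ H` with `H = {aⁱ} ∪ {x aⁱ}`,
  `x ∉ ⟨a⟩`, `x a = a⁻¹ x`, `x² = aᵐ`, and every involution of `H` equal to `aᵐ`.
* **`card_le_two_of_isComplement'_of_forall_isNondegenerate`** — the theorem above (`Nat.card E ≤ 2`).
* **`exists_isComplement'_card_le_two_of_forall_isNondegenerate`** — packaged with the reduction: GOOD + `2^n ≥ 64` + (H2) ⟹
  `∃ H E`, `H.IsComplement' E`, `E` central of exponent `2`, `|E| ≤ 2`, `c ∈ H ∖ E`, `H` cyclic or generalised quaternion.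

## References

* [Rotman1995] J. J. Rotman, *An Introduction to the Theory of Groups*, 4th ed., GTM 148, Springer 1995, Thm. 5.46.
* [Shimura1998] G. Shimura, *Abelian Varieties with Complex Multiplication and Modular Functions*, §6.2 Thm. 3, §8.2 Prop. 26, §18.2.
* [Kubota1965] T. Kubota, *On the field extension by complex multiplication*, Trans. AMS 118 (1965), §2 and §4 Lemma 2.
* [Gordon1999HodgeAVSurvey] B. B. Gordon, *A survey of the Hodge conjecture for abelian varieties*, Thm. 6.4, §9.3, §9.4.3.
-/

noncomputable section

open CategoryTheory CategoryTheory.Limits NumberField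
open scoped BigOperators

namespace Summit.HodgeConjecture.CorCM.GaloisModels

open Literature.NumberTheory.ComplexMultiplication
open Literature.AlgebraicGeometry.Motives (AbelianVariety CMType)
open Literature.AlgebraicGeometry.HodgeTheory
open Literature.AlgebraicGeometry.Pohlmann1968
open Summit.HodgeConjecture.CorCM.GaloisRank

/-! ## §1 Index-two data of a generalised quaternion subgroup -/

section Group

variable {G : Type*} [Group G]

/-- **Index-two data from `H ≃* QuaternionGroup m`.**  With `a ↦ a 1`, `x ↦ xa 0`: every element of `H` is `aⁱ` or `x aⁱ`
(`i : ℕ`), `x ∉ ⟨a⟩`, `x a = a⁻¹ x`, `x² = aᵐ`, and every involution of `H` equals `aᵐ`. [folklore] -/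
theorem exists_index_two_data_of_mulEquiv_quaternionGroup [Finite G] {m : ℕ} [NeZero m] (H : Subgroup G)
    (f : H ≃* QuaternionGroup m) :
    ∃ a x : G, a ∈ H ∧ x ∈ H ∧ (∀ h ∈ H, ∃ i : ℕ, h = a ^ i ∨ h = x * a ^ i) ∧ x ∉ Subgroup.zpowers a ∧
      x * a = a⁻¹ * x ∧ x * x = a ^ m ∧ (∀ s ∈ H, s * s = 1 → s ≠ 1 → s = a ^ m) := by
  classical
  set a : G := (f.symm (QuaternionGroup.a 1) : G) with ha
  set x : G := (f.symm (QuaternionGroup.xa 0) : G) with hx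
  have hapow : ∀ i : ℕ, (f.symm (QuaternionGroup.a (i : ZMod (2 * m))) : G) = a ^ i := fun i => by
    rw [← QuaternionGroup.a_one_pow, map_pow, Subgroup.coe_pow]
  refine ⟨a, x, (f.symm _).2, (f.symm _).2, fun h hh => ?_, ?_, ?_, ?_, fun s hs hss hs1 => ?_⟩
  · -- normal form
    obtain ⟨q, hq⟩ : ∃ q, f.symm q = ⟨h, hh⟩ := ⟨f ⟨h, hh⟩, f.symm_apply_apply _⟩
    rcases q with i | i
    · refine ⟨i.val, Or.inl ?_⟩
      rw [← hapow, ZMod.natCast_zmod_val, hq]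
    · refine ⟨i.val, Or.inr ?_⟩
      have : QuaternionGroup.xa i = QuaternionGroup.xa 0 * QuaternionGroup.a (i.val : ZMod (2 * m)) := by
        rw [QuaternionGroup.xa_mul_a, ZMod.natCast_zmod_val, zero_add]
      rw [← hapow, ← Subgroup.coe_mul, ← map_mul, ← this, hq]
  · -- `x ∉ ⟨a⟩`
    intro hxa
    rw [← mem_powers_iff_mem_zpowers, Submonoid.mem_powers_iff] at hxa
    obtain ⟨i, hi⟩ := hxa
    rw [← hapow] at hi
    have h2 := f.symm.injective (Subtype.ext hi)
    cases h2
  · -- `x a = a⁻¹ x`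
    have hinv : (QuaternionGroup.a 1 : QuaternionGroup m)⁻¹ = QuaternionGroup.a (-1) :=
      inv_eq_of_mul_eq_one_right (by rw [QuaternionGroup.a_mul_a, add_neg_cancel, QuaternionGroup.a_zero])
    rw [ha, hx, ← Subgroup.coe_inv, ← Subgroup.coe_mul, ← Subgroup.coe_mul, ← map_inv, ← map_mul, ← map_mul,
      QuaternionGroup.xa_mul_a, hinv, QuaternionGroup.a_mul_xa, zero_add, zero_sub, neg_neg]
  · -- `x² = aᵐ`
    rw [hx, ← Subgroup.coe_mul, ← map_mul, QuaternionGroup.xa_mul_xa, add_zero, sub_zero, hapow]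
  · -- involutions of `H`
    have hq : f ⟨s, hs⟩ * f ⟨s, hs⟩ = 1 := by
      rw [← map_mul, ← map_one f]
      congr 1
      exact Subtype.ext hss
    have hq1 : f ⟨s, hs⟩ ≠ 1 := fun h => hs1 (by
      have := congrArg Subtype.val (f.injective (h.trans (map_one f).symm))
      exact this)
    have h := GaloisDicyclic.eq_a_of_mul_self_eq_one (f ⟨s, hs⟩) hq hq1
    have h' : (⟨s, hs⟩ : H) = f.symm (QuaternionGroup.a (m : ZMod (2 * m))) := by
      rw [← h, f.symm_apply_apply]
    have := congrArg Subtype.val h'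
    rw [hapow] at this
    exact this

/-- Powers of an involution: `s² = 1 ⟹ sⁱ ∈ {1, s}`. [folklore] -/
theorem zpow_eq_one_or_eq_of_mul_self_eq_one {s : G} (hss : s * s = 1) (i : ℤ) : s ^ i = 1 ∨ s ^ i = s := by
  obtain ⟨j, hj | hj⟩ := Int.even_or_odd' i
  · left
    rw [hj, zpow_mul, zpow_two, hss, one_zpow]
  · right
    rw [hj, zpow_add, zpow_mul, zpow_two, hss, one_zpow, one_mul, zpow_one]

end Group

/-! ## §2 `|E| ≤ 2` -/

section Field

variable {K : Type} [Field K] [NumberField K] [IsCMField K] [IsGalois ℚ K]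

/-- **`|E| ≤ 2`.**  `K` Galois CM of degree `2^n`, `n ≥ 6`, GOOD; `Gal(K/ℚ) = H·E` with `H.IsComplement' E`, `E` central of exponent
`2`, `c ∈ H ∖ E` (`c` = complex conjugation), `|H| = 2^k`, `H` cyclic or `≃ QuaternionGroup (2^(k-2))` ⟹ `Nat.card E ≤ 2`.
(`|E| ≥ 4` ⟹ BAD: abelian classification if `H` is cyclic, gen 30's two-cyclic theorem with `A = ⟨a⟩·E` if `H` is quaternion.)
[cite: Shimura1998, §6.2 Thm. 3 and §8.2 Prop. 26] [cite: Kubota1965, §2 and §4 Lemma 2] [cite: Gordon1999HodgeAVSurvey, Thm. 6.4, §9.3 and §9.4.3] -/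
theorem card_le_two_of_isComplement'_of_forall_isNondegenerate {n : ℕ} (hdeg : Module.finrank ℚ K = 2 ^ n) (hn : 6 ≤ n)
    (hgood : ∀ (Φ : CMType K) (φ : K →+* ℂ), IsPrimitive (ℂ ≃+* ℂ) Φ.1 φ → IsNondegenerate Φ)
    (H E : Subgroup (K ≃ₐ[ℚ] K)) (hHE : H.IsComplement' E) (hcH : (IsCMField.complexConj K).restrictScalars ℚ ∈ H)
    (hcE : (IsCMField.complexConj K).restrictScalars ℚ ∉ E) (hE : ∀ e ∈ E, e * e = 1 ∧ ∀ g : K ≃ₐ[ℚ] K, g * e = e * g)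
    {k : ℕ} (hHcard : Nat.card H = 2 ^ k) (hstruct : IsCyclic H ∨ (3 ≤ k ∧ Nonempty (H ≃* QuaternionGroup (2 ^ (k - 2))))) :
    Nat.card E ≤ 2 := by
  classical
  by_contra hE2
  push Not at hE2
  set c := (IsCMField.complexConj K).restrictScalars ℚ with hc
  have hcc : c * c = 1 := model_complexConj_mul_self (MulEquiv.refl (K ≃ₐ[ℚ] K)) (by simp [hc])
  have hc1 : c ≠ 1 := model_complexConj_ne_one (MulEquiv.refl (K ≃ₐ[ℚ] K)) (by simp [hc])
  have hccen : ∀ g : K ≃ₐ[ℚ] K, g * c = c * g := fun g =>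
    (model_complexConj_comm (MulEquiv.refl (K ≃ₐ[ℚ] K)) (by simp [hc]) g).symm
  have hcard : Nat.card (K ≃ₐ[ℚ] K) = 2 ^ n := by rw [Nat.card_eq_fintype_card, card_model_eq_finrank (MulEquiv.refl _), hdeg]
  have h64 : 64 ≤ 2 ^ n := le_trans (by norm_num) (Nat.pow_le_pow_right (by norm_num) hn : 2 ^ 6 ≤ 2 ^ n)
  have hcen : ∀ e ∈ E, ∀ g : K ≃ₐ[ℚ] K, g * e = e * g := fun e he => (hE e he).2
  haveI hEn : E.Normal := ⟨fun e he g => by rw [hcen e he g, mul_inv_cancel_right]; exact he⟩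
  have hHEcard : Nat.card H * Nat.card E = 2 ^ n := by rw [hHE.card_mul, hcard]
  have hdisj : ∀ g : K ≃ₐ[ℚ] K, g ∈ H → g ∈ E → g = 1 := fun g hgH hgE => Subgroup.disjoint_def.1 hHE.disjoint hgH hgE
  have hdecomp : ∀ g : K ≃ₐ[ℚ] K, ∃ h ∈ H, ∃ e ∈ E, h * e = g := fun g => by
    obtain ⟨⟨h, e⟩, rfl⟩ := hHE.2 g
    exact ⟨h, h.2, e, e.2, rfl⟩
  -- two independent involutions `t₁, t₂ ∈ E`
  obtain ⟨t₁, ht₁E, ht₁⟩ : ∃ t₁ ∈ E, t₁ ≠ 1 := by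
    by_contra h
    push Not at h
    have : E = ⊥ := (Subgroup.eq_bot_iff_forall E).2 h
    rw [this, Subgroup.card_bot] at hE2
    omega
  obtain ⟨t₂, ht₂E, ht₂, ht₂₁⟩ : ∃ t₂ ∈ E, t₂ ≠ 1 ∧ t₂ ≠ t₁ := by
    by_contra h
    push Not at h
    have hle : E ≤ Subgroup.zpowers t₁ := fun e he => by
      by_cases he1 : e = 1
      · rw [he1]; exact one_mem _
      · rw [h e he he1]; exact Subgroup.mem_zpowers t₁
    have := Subgroup.card_le_of_le hle
    rw [Nat.card_zpowers, orderOf_eq_prime (by rw [pow_two]; exact (hE t₁ ht₁E).1) ht₁] at this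
    omega
  have ht₁t₁ := (hE t₁ ht₁E).1; have ht₂t₂ := (hE t₂ ht₂E).1
  -- `k ≥ 1`
  have hk1 : 1 ≤ k := by
    by_contra h
    have hk0 : k = 0 := by omega
    rw [hk0, pow_zero] at hHcard
    haveI := (Nat.card_eq_one_iff_unique.mp hHcard).1
    exact hc1 (congrArg Subtype.val (Subsingleton.elim (⟨c, hcH⟩ : H) 1))
  rcases hstruct with hcyc | ⟨hk3, ⟨f⟩⟩
  · -- CASE `H` CYCLIC: `Gal(K/ℚ)` is abelian and complex conjugation lies in no cyclic subgroup of index `≤ 2`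
    letI := IsCyclic.commGroup (α := H)
    have hcommH : ∀ h₁ ∈ H, ∀ h₂ ∈ H, h₁ * h₂ = h₂ * h₁ := fun h₁ hh₁ h₂ hh₂ => by
      have := mul_comm (⟨h₁, hh₁⟩ : H) ⟨h₂, hh₂⟩
      exact congrArg Subtype.val this
    have hcomm : ∀ g₁ g₂ : K ≃ₐ[ℚ] K, g₁ * g₂ = g₂ * g₁ := by
      intro g₁ g₂
      obtain ⟨h₁, hh₁, e₁, he₁, rfl⟩ := hdecomp g₁
      obtain ⟨h₂, hh₂, e₂, he₂, rfl⟩ := hdecomp g₂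
      rw [show h₁ * e₁ * (h₂ * e₂) = (h₁ * h₂) * (e₁ * e₂) by
          rw [mul_assoc, ← mul_assoc e₁, ← hcen e₁ he₁ h₂]; group,
        show h₂ * e₂ * (h₁ * e₁) = (h₂ * h₁) * (e₂ * e₁) by
          rw [mul_assoc, ← mul_assoc e₂, ← hcen e₂ he₂ h₁]; group,
        hcommH h₁ hh₁ h₂ hh₂, hcen e₁ he₁ e₂]
    have hα : ¬ ∃ z : K ≃ₐ[ℚ] K, c ∈ Subgroup.zpowers z ∧ (Subgroup.zpowers z).index ≤ 2 := by
      rintro ⟨z, -, hidx⟩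
      obtain ⟨h, hh, e, he, rfl⟩ := hdecomp z
      have hpow : (h * e) ^ (2 ^ k) = 1 := by
        rw [(show Commute h e from hcen e he h).mul_pow]
        have h1 : h ^ (2 ^ k) = 1 := by
          have := pow_card_eq_one' (G := H) (x := ⟨h, hh⟩)
          rw [hHcard] at this
          exact congrArg Subtype.val this
        have h2 : e ^ (2 ^ k) = 1 := by
          rw [show 2 ^ k = 2 * 2 ^ (k - 1) by rw [← pow_succ', Nat.sub_add_cancel hk1], pow_mul, pow_two, (hE e he).1,
            one_pow]
        rw [h1, h2, one_mul]
      have hord : orderOf (h * e) ≤ 2 ^ k := Nat.le_of_dvd (by positivity) (orderOf_dvd_of_pow_eq_one hpow)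
      have h1 := (Subgroup.zpowers (h * e)).index_mul_card
      rw [Nat.card_zpowers, hcard, ← hHEcard, hHcard] at h1
      have : 2 ^ k * Nat.card E ≤ 2 * 2 ^ k := by
        calc 2 ^ k * Nat.card E = (Subgroup.zpowers (h * e)).index * orderOf (h * e) := h1.symm
          _ ≤ 2 * 2 ^ k := Nat.mul_le_mul hidx hord
      have hpos : 0 < 2 ^ k := by positivity
      nlinarith
    obtain ⟨Φ, φ₀, A, ι, θ, H1, H2, -⟩ :=
      AbelianTwoPowerClassification.exists_simple_degenerate_of_not_thin_of_le_finrank hcomm (n := n - 1)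
        (by rw [hdeg, Nat.sub_add_cancel (by omega)]) (by rw [hdeg]; omega) hα
    exact H2 (hgood Φ φ₀ H1)
  · -- CASE `H` QUATERNION: the abelian index-two subgroup `A = ⟨a⟩·E` with the independent involutions `t₁, t₂`
    haveI : NeZero (2 ^ (k - 2)) := ⟨by positivity⟩
    obtain ⟨a, x, haH, hxH, hform, hxa0, hxa, hxx, hinvol⟩ := exists_index_two_data_of_mulEquiv_quaternionGroup H f
    set m := 2 ^ (k - 2) with hm
    have hcam : c = a ^ m := hinvol c hcH hcc hc1
    have hxa' : x * a * x⁻¹ = a⁻¹ := mul_inv_eq_iff_eq_mul.2 hxa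
    have hxai : ∀ i : ℤ, x * a ^ i * x⁻¹ = a ^ (-i) := fun i => by
      rw [← MulAut.conj_apply, map_zpow, MulAut.conj_apply, hxa', inv_zpow, zpow_neg]
    -- the subgroup `A = ⟨a⟩ ⊔ E`
    set A := Subgroup.zpowers a ⊔ E with hA
    have hmemA : ∀ g : K ≃ₐ[ℚ] K, g ∈ A ↔ ∃ i : ℤ, ∃ e ∈ E, a ^ i * e = g := by
      intro g
      rw [hA, Subgroup.mem_sup_of_normal_right]
      constructor
      · rintro ⟨y, hy, e, he, hye⟩
        rw [Subgroup.mem_zpowers_iff] at hy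
        obtain ⟨i, rfl⟩ := hy
        exact ⟨i, e, he, hye⟩
      · rintro ⟨i, e, he, hie⟩
        exact ⟨a ^ i, Subgroup.zpow_mem _ (Subgroup.mem_zpowers a) i, e, he, hie⟩
    have haA : ∀ i : ℤ, a ^ i ∈ A := fun i => (hmemA _).2 ⟨i, 1, E.one_mem, mul_one _⟩
    have hEA : E ≤ A := fun e he => (hmemA e).2 ⟨0, e, he, by rw [zpow_zero, one_mul]⟩
    have hcA : c ∈ A := by rw [hcam, ← zpow_natCast]; exact haA _
    -- conjugation of `a^i` by any element lands in `{a^i, a^(-i)}`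
    have hconjH : ∀ h ∈ H, ∀ i : ℤ, h * a ^ i * h⁻¹ = a ^ i ∨ h * a ^ i * h⁻¹ = a ^ (-i) := by
      intro h hh i
      obtain ⟨j, rfl | rfl⟩ := hform h hh
      · left
        rw [← zpow_natCast]
        group
      · right
        rw [show x * a ^ j * a ^ i * (x * a ^ j)⁻¹ = x * a ^ i * x⁻¹ by rw [← zpow_natCast]; group, hxai]
    have hconjA : ∀ (g : K ≃ₐ[ℚ] K) (i : ℤ), g * a ^ i * g⁻¹ ∈ A := by
      intro g i
      obtain ⟨h, hh, e, he, rfl⟩ := hdecomp g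
      have : h * e * a ^ i * (h * e)⁻¹ = h * a ^ i * h⁻¹ := by
        rw [show h * e * a ^ i * (h * e)⁻¹ = h * (e * a ^ i * e⁻¹) * h⁻¹ by group, ← hcen e he (a ^ i),
          mul_inv_cancel_right]
      rw [this]
      rcases hconjH h hh i with h' | h' <;> rw [h'] <;> exact haA _
    haveI hAn : A.Normal := by
      refine ⟨fun u hu g => ?_⟩
      obtain ⟨i, e, he, rfl⟩ := (hmemA u).1 hu
      rw [show g * (a ^ i * e) * g⁻¹ = (g * a ^ i * g⁻¹) * (g * e * g⁻¹) by group, hcen e he g, mul_inv_cancel_right]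
      exact A.mul_mem (hconjA g i) (hEA he)
    have hcommA : ∀ u ∈ A, ∀ v ∈ A, u * v = v * u := by
      intro u hu v hv
      obtain ⟨i, e, he, rfl⟩ := (hmemA u).1 hu
      obtain ⟨j, e', he', rfl⟩ := (hmemA v).1 hv
      have h1 : a ^ i * e * (a ^ j * e') = a ^ (i + j) * (e * e') := by
        rw [show a ^ i * e * (a ^ j * e') = a ^ i * (e * a ^ j) * e' by group, ← hcen e he (a ^ j), zpow_add]
        group
      have h2 : a ^ j * e' * (a ^ i * e) = a ^ (i + j) * (e * e') := by
        rw [show a ^ j * e' * (a ^ i * e) = a ^ j * (e' * a ^ i) * e by group, ← hcen e' he' (a ^ i), zpow_add,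
          ← hcen e he e']
        group
      rw [h1, h2]
    letI : CommGroup A := { (inferInstance : Group A) with mul_comm := fun u v => Subtype.ext (hcommA u u.2 v v.2) }
    -- `x ∉ A`, the coset decomposition, the index
    have hxA : x ∉ A := by
      intro h
      obtain ⟨i, e, he, hxe⟩ := (hmemA x).1 h
      have heH : e ∈ H := by
        rw [show e = (a ^ i)⁻¹ * x by rw [← hxe, inv_mul_cancel_left]]
        exact H.mul_mem (H.inv_mem (H.zpow_mem haH i)) hxH
      have he1 := hdisj e heH he
      rw [he1, mul_one] at hxe
      exact hxa0 (hxe ▸ Subgroup.zpow_mem _ (Subgroup.mem_zpowers a) i)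
    have hcov : ∀ g : K ≃ₐ[ℚ] K, (∃ u : A, g = A.subtype u) ∨ (∃ u : A, g = A.subtype u * x) := by
      intro g
      obtain ⟨h, hh, e, he, rfl⟩ := hdecomp g
      obtain ⟨j, rfl | rfl⟩ := hform h hh
      · left
        refine ⟨⟨a ^ j * e, (hmemA _).2 ⟨j, e, he, by rw [zpow_natCast]⟩⟩, rfl⟩
      · right
        have hmem : x * a ^ j * x⁻¹ * e ∈ A := A.mul_mem (by rw [← zpow_natCast]; exact hconjA x j) (hEA he)
        refine ⟨⟨x * a ^ j * x⁻¹ * e, hmem⟩, ?_⟩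
        rw [Subgroup.coe_subtype]
        rw [show x * a ^ j * x⁻¹ * e * x = x * a ^ j * x⁻¹ * (e * x) by group, ← hcen e he x]
        group
    have hxq : x * x ∈ A := by rw [hxx, ← zpow_natCast]; exact haA _
    have hAidx : A.index = 2 := by
      rw [Subgroup.index_eq_two_iff]
      refine ⟨x, fun b => ?_⟩
      by_cases hb : b ∈ A
      · refine Or.inr ⟨hb, fun hbx => hxA ?_⟩
        have := A.mul_mem (A.inv_mem hb) hbx
        rwa [inv_mul_cancel_left] at this
      · refine Or.inl ⟨?_, hb⟩
        rcases hcov b with ⟨u, hu⟩ | ⟨u, hu⟩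
        · exact absurd (hu ▸ u.2) hb
        · rw [hu, Subgroup.coe_subtype, mul_assoc]
          exact A.mul_mem u.2 hxq
    have hAcard : Nat.card A = 2 ^ (n - 1) := by
      have h1 := A.index_mul_card
      rw [hAidx, hcard, show 2 ^ n = 2 * 2 ^ (n - 1) by rw [← pow_succ', Nat.sub_add_cancel (by omega)]] at h1
      exact Nat.eq_of_mul_eq_mul_left (by norm_num) h1
    have hAcard' : Fintype.card A = 2 ^ (n - 1) := by rw [← Nat.card_eq_fintype_card, hAcard]
    have h32 : 32 ≤ 2 ^ (n - 1) := le_trans (by norm_num) (Nat.pow_le_pow_right (by norm_num) (by omega) : 2 ^ 5 ≤ 2 ^ (n - 1))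
    -- the index-two data
    let θ : A ≃* A := MulAut.conjNormal x
    have hθ : ∀ u : A, x * A.subtype u = A.subtype (θ u) * x := fun u => by
      show x * (u : K ≃ₐ[ℚ] K) = (MulAut.conjNormal x u : K ≃ₐ[ℚ] K) * x
      rw [MulAut.conjNormal_apply, inv_mul_cancel_right]
    let q : A := ⟨x * x, hxq⟩; let c' : A := ⟨c, hcA⟩
    let u₀ : A := ⟨t₁, hEA ht₁E⟩; let u₁ : A := ⟨t₂, hEA ht₂E⟩
    have hu₀u₀ : u₀ * u₀ = 1 := Subtype.ext ht₁t₁; have hu₁u₁ : u₁ * u₁ = 1 := Subtype.ext ht₂t₂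
    have hc'c' : c' * c' = 1 := Subtype.ext hcc
    have hu₀1 : u₀ ≠ 1 := fun h => ht₁ (congrArg Subtype.val h); have hu₁1 : u₁ ≠ 1 := fun h => ht₂ (congrArg Subtype.val h)
    have hcu₀ : c' ∉ Subgroup.zpowers u₀ := fun h => by
      rcases AbelianOddPart.eq_one_or_eq_of_mem_zpowers hu₀u₀ h with h1 | h1
      · exact hc1 (congrArg Subtype.val h1)
      · exact hcE (by rw [show c = t₁ from congrArg Subtype.val h1]; exact ht₁E)
    have hcu₁ : c' ∉ Subgroup.zpowers u₁ := fun h => by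
      rcases AbelianOddPart.eq_one_or_eq_of_mem_zpowers hu₁u₁ h with h1 | h1
      · exact hc1 (congrArg Subtype.val h1)
      · exact hcE (by rw [show c = t₂ from congrArg Subtype.val h1]; exact ht₂E)
    have hind : u₁ ∉ Subgroup.closure ({u₀, c'} : Set A) := by
      intro h
      rw [Subgroup.mem_closure_pair] at h
      obtain ⟨i, j, hij⟩ := h
      rcases zpow_eq_one_or_eq_of_mul_self_eq_one hu₀u₀ i with hi | hi <;>
        rcases zpow_eq_one_or_eq_of_mul_self_eq_one hc'c' j with hj | hj <;> rw [hi, hj] at hij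
      · exact hu₁1 (by rw [← hij, one_mul])
      · exact hcE (by rw [show c = t₂ from congrArg Subtype.val (by rw [← hij, one_mul] : c' = u₁)]; exact ht₂E)
      · exact ht₂₁ (congrArg Subtype.val (by rw [← hij, mul_one] : u₁ = u₀))
      · apply hcE
        have : c = t₁ * t₂ := by
          have h' := congrArg Subtype.val hij
          simp only [Subgroup.coe_mul] at h'
          -- `t₁ * c = t₂` ⟹ `c = t₁ * t₂`
          calc c = t₁ * (t₁ * c) := by rw [← mul_assoc, ht₁t₁, one_mul]
            _ = t₁ * t₂ := by rw [h']
        rw [this]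
        exact E.mul_mem ht₁E ht₂E
    have hint : ∀ w : A, w ∈ Subgroup.zpowers u₀ → w ∈ Subgroup.zpowers u₁ → w = 1 := by
      intro w hw₀ hw₁
      rcases AbelianOddPart.eq_one_or_eq_of_mem_zpowers hu₀u₀ hw₀ with h | h
      · exact h
      · rcases AbelianOddPart.eq_one_or_eq_of_mem_zpowers hu₁u₁ hw₁ with h' | h'
        · exact h'
        · exact absurd (congrArg Subtype.val (h.symm.trans h')) (Ne.symm ht₂₁)
    have hθu₀ : θ u₀ = u₀ := by
      apply Subtype.ext
      show (MulAut.conjNormal x u₀ : K ≃ₐ[ℚ] K) = t₁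
      rw [MulAut.conjNormal_apply]
      show x * t₁ * x⁻¹ = t₁
      rw [hcen t₁ ht₁E x, mul_inv_cancel_right]
    have hθU : θ u₀ ∉ Subgroup.zpowers u₁ := by
      rw [hθu₀]
      intro h
      rcases AbelianOddPart.eq_one_or_eq_of_mem_zpowers hu₁u₁ h with h' | h'
      · exact hu₀1 h'
      · exact ht₂₁ (congrArg Subtype.val h').symm
    have hQ₀ : 4 * orderOf u₀ < Fintype.card A := by rw [orderOf_eq_prime (by rw [pow_two, hu₀u₀]) hu₀1, hAcard']; omega
    have hQ₁ : 4 * orderOf u₁ < Fintype.card A := by rw [orderOf_eq_prime (by rw [pow_two, hu₁u₁]) hu₁1, hAcard']; omega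
    obtain ⟨Φ, φ₀, X, ι, ϑ, H1, H2, -⟩ :=
      SplitInvolution.exists_simple_degenerate_of_two_cyclic (MulEquiv.refl (K ≃ₐ[ℚ] K)) A.subtype
        Subtype.coe_injective x (fun u h => hxA (h ▸ u.2)) hcov θ hθ q rfl c' rfl u₀ u₁ hcu₀ hcu₁ hu₀1 hind hint hθU hQ₀ hQ₁
    exact H2 (hgood Φ φ₀ H1)

/-- **GOOD + (H2) ⟹ `Gal(K/ℚ) = H × E` WITH `|E| ≤ 2`** (packaged with `CorCM/GaloisTwoPowerOrderFourReduction`): `K` Galois CM,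
`[K:ℚ] = 2^n`, `n ≥ 6`, every primitive CM type nondegenerate, every `σ ∈ Gal(K/ℚ)` with `σ⁴ = 1` having `σ² ∈ {1, c}`.  Then
`Gal(K/ℚ) = H·E`, `H ∩ E = 1`, `E` central of exponent `2` with `|E| ≤ 2` and `c ∉ E`, `c ∈ H`, `|H| = 2^k`, `H` cyclic or
`≃ QuaternionGroup (2^(k-2))` — i.e. `Gal(K/ℚ)` is `C_{2^n}`, `Q_{2^n}`, `C_{2^(n-1)} × C₂` or `Q_{2^(n-1)} × C₂` with `c` in the first
factor. [cite: Rotman1995, Thm. 5.46] [cite: Shimura1998, §8.2 Prop. 26 and §18.2] [cite: Gordon1999HodgeAVSurvey, §9.3 and §9.4.3] -/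
theorem exists_isComplement'_card_le_two_of_forall_isNondegenerate {n : ℕ} (hdeg : Module.finrank ℚ K = 2 ^ n) (hn : 6 ≤ n)
    (hgood : ∀ (Φ : CMType K) (φ : K →+* ℂ), IsPrimitive (ℂ ≃+* ℂ) Φ.1 φ → IsNondegenerate Φ)
    (hsq : ∀ σ : K ≃ₐ[ℚ] K, σ ^ 4 = 1 → σ * σ = 1 ∨ σ * σ = (IsCMField.complexConj K).restrictScalars ℚ) :
    ∃ (H E : Subgroup (K ≃ₐ[ℚ] K)) (k : ℕ), H.IsComplement' E ∧ (IsCMField.complexConj K).restrictScalars ℚ ∈ H ∧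
      (IsCMField.complexConj K).restrictScalars ℚ ∉ E ∧ (∀ e ∈ E, e * e = 1 ∧ ∀ g : K ≃ₐ[ℚ] K, g * e = e * g) ∧
      Nat.card E ≤ 2 ∧ Nat.card H = 2 ^ k ∧ (IsCyclic H ∨ (3 ≤ k ∧ Nonempty (H ≃* QuaternionGroup (2 ^ (k - 2))))) := by
  obtain ⟨H, E, k, hHE, hcH, hcE, hE, hHcard, hstruct⟩ := exists_isComplement'_of_forall_isNondegenerate hdeg hn hgood hsq
  exact ⟨H, E, k, hHE, hcH, hcE, hE,
    card_le_two_of_isComplement'_of_forall_isNondegenerate hdeg hn hgood H E hHE hcH hcE hE hHcard hstruct, hHcard, hstruct⟩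

end Field

end Summit.HodgeConjecture.CorCM.GaloisModels
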